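/-
Copyright (c) 2026. All rights reserved.
Released under Apache 2.0 license as described in the file LICENSE.
Authors: abc-iut cell, F-wave prover seat abc-iut-f-101 (gen 4), over abc-iut-w6-d036's genuine Prop 5.8 (vii) setting
(`LogFrobeniusMonoGenuineProp58vii.lean`), abc-iut-L4-t9's MLF model categories, abc-iut-w4-d095's genuine §5 rows,
abc-iut-L6-d2's `log_k̄ : k~ ⥲ k̄` and this seat's perfection containers (see the imports).
-/
import Literature.AnabelianGeometry.AbsoluteAnabelian.LogFrobeniusMonoGenuineProp58vii
import Literature.AnabelianGeometry.AbsoluteAnabelian.AbsTopIII.MLFGaloisMonoAnabelianPerfectionCarriers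
import HarnessLib

/-!
# [AbsTopIII] Cor 5.10 (iv)(c): the COMPONENTS of the printed isomorphisms `η⊢_{v,ν}` at the genuine nonarchimedean
# mono-analytic model, at an object with OPEN augmentation — the four vertices of `Γ⃗×_non`

S. Mochizuki, *Topics in absolute anabelian geometry III: global reconstruction algorithms*, J. Math. Sci. Univ.
Tokyo 22 (2015) 939–1156 [MochizukiAbsTopIII2015]; locators = pages of the author's manuscript
(`paper:url-5493eb38cbb7`), read on the page: Cor 5.10 (iv)(c) p. 148 ("isomorphisms `η⊢_{v,ν}` … between the
composites `□ → 𝒩⊞_v → 𝒩_v → ℰ• → ℰ⊢ → An⊢ → 𝒩⊢⊞_v` and `□ → 𝒩⊞_v → 𝒩⊢⊞_v`"), Def 5.6 (iii) p. 136 (the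
mono-analyticization `𝒩_v → 𝒩⊢_v`, `(Π ↷ M) ↦ (G ↷ M)`), Def 3.1 (i)/(ii) pp. 66–67 (`Π_k ↠ G_k`, "continuous surjection";
"of mono-analytic type"), Def 3.1 (iv) p. 69 (`λ^×`, `λ^{×pf}`), Def 5.4 (iii) p. 126 (`Γ⃗^log_non`), Prop 5.8 (ii)/(vii)
pp. 139–142 (the containers `Γ⃗×_non(G)` and `ψ^{An⊢⊞}_{w,ν}`).

## What this file builds (node [AbsTopIII] Cor 5.10 (iv), layer L4; L4-lead m88/m99/m104 row «MTC-GENUINE-POSITIVE», part 1)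

The (d)-datum `η⊢_{v,ν}` of abc-iut-L4-t3's add-on `MonoTelecoreCoherence` compares, at an object `A = (Π_k ↠ G_k ↷ ℚ̄_p)`
of the holomorphic model and a vertex `ν ∈ Γ⃗×_v`, the GENUINE mono-analytic container `(G_k ↷ M_ν(G_k))` (abc-iut-w6-d036
/ this seat: `unitsObj`, `timesObj`, `unitsPfObj`, `timesPfObj` of `closure A`) with the mono-analyticization
`(Π_k/Ker ↷ M_ν)` of the holomorphic container (`TSObj.monoAn` of abc-iut-w4-d095 / abc-iut-L4-t9's `lamUnitsObj`,
`lamTimesObj`, `lamAddObj`, `lamTimesPfObj`).  abc-iut-f-101 (STATUS 2026-08-26 22:24Z, L4-lead m99): such an isomorphism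
needs `Gal(ℚ̄_p/k) ≃ₜ* Π_k/Ker ε_k` as TOPOLOGICAL groups, which FAILS when `ε_k` is not open (the model category only
asks "continuous surjection") — so everything here is under the hypothesis `IsOpenMap A.D.aug` (automatic for print's
profinite `Π_X`).  Contents:

* `TFModel.augQuotientIso A hA N hN : (Π_k ⧸ N) ≃ₜ* Gal(ℚ̄_p/k)` for any `N = Ker(Π_k ↷ ℚ̄_p)` (the four vertex kernels are
  equal to it only propositionally), with `augQuotientIso_mk`, `augQuotientIso_symm_aug`;
* `TSObj.isoOfEquivariant` — an isomorphism of `𝒞_TS` between pairs of mono-analytic type from an isomorphism of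
  topological groups and an equivariant bijection of (discrete) arithmetic data;
* `TFModel.transport_toMonoBase_map` — for a Galois-isomorphism `f` of the holomorphic model, the canonical LCFT transport
  along `conj(σ_f)` IS `σ_f` on `k̄^×` (uniqueness of abc-iut-w6-d036's `IsTransport`);
* **the four components**: `etaUnitsIso` (`𝒪^×`, carrier `PadicAlgCl.unitSubmonoid_subfield_eq`), `etaTimesIso` (`k̄^×`),
  ★ `etaShellIso` (`k~ = (𝒪^×)^pf ⥲ (k̄, +)` by abc-iut-L6-d2's `logEquiv` of `GaloisPadicLog.ofPadicSubfield`, i.e. the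
  GENUINE `p`-adic logarithm), `etaPerfIso` (`(k̄^×)^pf`, identity on classes) — each `𝒞_TS`-isomorphism
  `(G_k ↷ M_ν(G_k)) ≅ (Π_k/Ker ↷ M_ν)` with Galois leg `(augQuotientIso …).symm` — and their values on data (`_hom_homM…`).

Part 2 (`LogFrobeniusMonoEtaNaturality.lean`, this seat) proves their naturality in Galois-isomorphisms; the assembly of
`MonoTelecoreCoherence` and the pinned Cor 5.10 (iv)(b)(c) at the open-augmentation setting follows abc-iut-w5-d053's
sub-model and abc-iut-w4-d095's `nonarchGenuineMonoAnPf`.  HONEST FRAMING: MODEL-LEVEL (one nonarchimedean place, discrete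
arithmetic data per Rmk 3.1.1); classical local class field theory and the `p`-adic logarithm as proved in the tree;
refereed pre-IUT material; nothing here bears on [IUTchIII] Cor. 3.12; no side taken; typed ≠ proved.
-/

set_option autoImplicit false

noncomputable section

namespace Literature.AnabelianGeometry.AbsoluteAnabelian

open CategoryTheory Topology
open Literature.NumberTheory.Transcendental
open scoped nonZeroDivisors

namespace AbsTopIII

/-! ## Part 1. `Π_k ⧸ Ker ε_k ≃ₜ* Gal(ℚ̄_p/k)` for an OPEN augmentation -/

namespace TFModel

variable {p : ℕ} [Fact p.Prime] (A : TFModel p)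

section AugQuotient

variable (N : Subgroup A.pair.Pi) [N.Normal] (hN : N = A.pair.actionKer)

/-- `ε_k` descended to `Π_k ⧸ N` for `N = Ker(Π_k ↷ ℚ̄_p) = Ker ε_k`. [cite: MochizukiAbsTopIII2015, Definition 3.1 (i) p.66] -/
def augQuotientHom : A.pair.Pi ⧸ N →* (PadicAlgCl p ≃ₐ[A.k] PadicAlgCl p) :=
  QuotientGroup.lift N A.D.aug (hN.trans (actionKer_pair_eq A)).le

/-- `augQuotientHom [g] = ε_k(g)`. [cite: MochizukiAbsTopIII2015, Definition 3.1 (i) p.66] -/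
@[simp] theorem augQuotientHom_mk (g : A.pair.Pi) : A.augQuotientHom N hN (QuotientGroup.mk g) = A.D.aug g := rfl

/-- The descended augmentation is bijective (`ε_k` onto, kernel `N`). [cite: MochizukiAbsTopIII2015, Definition 3.1 (i) p.66] -/
theorem augQuotientHom_bijective : Function.Bijective (A.augQuotientHom N hN) := by
  constructor
  · rw [← MonoidHom.ker_eq_bot_iff, eq_bot_iff]
    intro x hx
    induction x using QuotientGroup.induction_on with
    | H g =>
      rw [MonoidHom.mem_ker, augQuotientHom_mk] at hx
      rw [Subgroup.mem_bot, QuotientGroup.eq_one_iff, hN, actionKer_pair_eq]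
      exact hx
  · intro σ
    obtain ⟨g, rfl⟩ := A.D.aug_surjective σ
    exact ⟨QuotientGroup.mk g, rfl⟩

/-- The descended augmentation is continuous (quotient topology). [cite: MochizukiAbsTopIII2015, Definition 3.1 (i) p.66] -/
theorem augQuotientHom_continuous : Continuous (A.augQuotientHom N hN) := by
  rw [← (QuotientGroup.isOpenQuotientMap_mk (N := N)).continuous_comp_iff]
  exact A.D.continuous_aug

/-- If `ε_k` is OPEN, so is the descended augmentation. [cite: MochizukiAbsTopIII2015, Definition 3.1 (i) p.66] -/
theorem augQuotientHom_isOpenMap (hA : IsOpenMap A.D.aug) : IsOpenMap (A.augQuotientHom N hN) := by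
  intro U hU
  have himg : (A.augQuotientHom N hN) '' U = A.D.aug '' (QuotientGroup.mk ⁻¹' U) := by
    conv_lhs => rw [← Set.image_preimage_eq U (QuotientGroup.mk_surjective (s := N))]
    rw [Set.image_image]
    rfl
  rw [himg]
  exact hA _ (hU.preimage QuotientGroup.continuous_mk)

variable (hA : IsOpenMap A.D.aug)

/-- **`Π_k ⧸ Ker ε_k ≃ₜ* G_k = Gal(ℚ̄_p/k)` as TOPOLOGICAL groups when `ε_k` is open** (print's `Π_X` is profinite, so a
continuous surjection onto `G_k` is automatically open; at the model this is the hypothesis `hA`) — stated for any subgroup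
`N` equal to the action kernel (the four vertex pairs of `Γ⃗×_non` have propositionally-equal, syntactically different
kernels). [cite: MochizukiAbsTopIII2015, Definition 3.1 (ii) p.67] -/
def augQuotientIso : (A.pair.Pi ⧸ N) ≃ₜ* (PadicAlgCl p ≃ₐ[A.k] PadicAlgCl p) :=
  ContinuousMulEquiv.mk'
    ((Equiv.ofBijective _ (A.augQuotientHom_bijective N hN)).toHomeomorphOfContinuousOpen
      (A.augQuotientHom_continuous N hN) (A.augQuotientHom_isOpenMap N hN hA))
    (map_mul (A.augQuotientHom N hN))

/-- `augQuotientIso [g] = ε_k(g)`. [cite: MochizukiAbsTopIII2015, Definition 3.1 (i) p.66] -/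
@[simp] theorem augQuotientIso_mk (g : A.pair.Pi) : A.augQuotientIso N hN hA (QuotientGroup.mk g) = A.D.aug g := rfl

/-- `augQuotientIso⁻¹ (ε_k g) = [g]`. [cite: MochizukiAbsTopIII2015, Definition 3.1 (i) p.66] -/
@[simp] theorem augQuotientIso_symm_aug (g : A.pair.Pi) :
    (A.augQuotientIso N hN hA).symm (A.D.aug g) = QuotientGroup.mk g :=
  (A.augQuotientIso N hN hA).injective (by rw [ContinuousMulEquiv.apply_symm_apply, augQuotientIso_mk])

end AugQuotient

end TFModel

/-! ## Part 2. Isomorphisms of `𝒞_TS` from equivariant bijections -/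

namespace TSObj

/-- An ISOMORPHISM of `𝒞_TS` between pairs of mono-analytic type (trivial action kernels) with discrete arithmetic data, from
an isomorphism of topological groups `α` and an `α`-equivariant bijection `f` (both directions are abc-iut-w6-d036's
`homOfEquivariant`). [cite: MochizukiAbsTopIII2015, Definition 3.1 (ii) p.67] -/
def isoOfEquivariant {P Q : TSObj} (hP : P.actionKer = ⊥) (hQ : Q.actionKer = ⊥) (hdP : DiscreteTopology P.pair.M)
    (hdQ : DiscreteTopology Q.pair.M) (α : P.pair.Pi ≃ₜ* Q.pair.Pi) (f : P.pair.M ≃ Q.pair.M)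
    (hf : ∀ (g : P.pair.Pi) (x : P.pair.M), f (g • x) = α g • f x) : P ≅ Q where
  hom := MLFClosure.homOfEquivariant hP hQ hdP α f hf
  inv := MLFClosure.homOfEquivariant hQ hP hdQ α.symm f.symm fun g y => f.injective (by
    rw [hf, f.apply_symm_apply, f.apply_symm_apply, ContinuousMulEquiv.apply_symm_apply])
  hom_inv_id := TSObj.Hom.ext (MonoidHom.ext fun g => α.symm_apply_apply g) (funext fun x => f.symm_apply_apply x)
  inv_hom_id := TSObj.Hom.ext (MonoidHom.ext fun g => α.apply_symm_apply g) (funext fun x => f.apply_symm_apply x)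

/-- Variant of `isoOfEquivariant` with the Galois leg presented from the TARGET side (`β : Π_Q ⥲ Π_P`, `α := β⁻¹`) and the
equivariance checked on `β q` — the form in which a quotient presentation `Π/Ker ⥲ G` is used. [cite: MochizukiAbsTopIII2015, Definition 3.1 (ii) p.67] -/
def isoOfEquivariant' {P Q : TSObj} (hP : P.actionKer = ⊥) (hQ : Q.actionKer = ⊥) (hdP : DiscreteTopology P.pair.M)
    (hdQ : DiscreteTopology Q.pair.M) (β : Q.pair.Pi ≃ₜ* P.pair.Pi) (f : P.pair.M ≃ Q.pair.M)
    (hf : ∀ (q : Q.pair.Pi) (x : P.pair.M), f (β q • x) = q • f x) : P ≅ Q :=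
  isoOfEquivariant hP hQ hdP hdQ β.symm f fun g x => by
    have h := hf (β.symm g) x
    rwa [ContinuousMulEquiv.apply_symm_apply] at h

/-- `isoOfEquivariant'` on arithmetic data is `f`. [cite: MochizukiAbsTopIII2015, Definition 3.1 (ii) p.67] -/
@[simp] theorem isoOfEquivariant'_hom_homM {P Q : TSObj} (hP : P.actionKer = ⊥) (hQ : Q.actionKer = ⊥)
    (hdP : DiscreteTopology P.pair.M) (hdQ : DiscreteTopology Q.pair.M) (β : Q.pair.Pi ≃ₜ* P.pair.Pi)
    (f : P.pair.M ≃ Q.pair.M) (hf : ∀ (q : Q.pair.Pi) (x : P.pair.M), f (β q • x) = q • f x) (x : P.pair.M) :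
    (isoOfEquivariant' hP hQ hdP hdQ β f hf).hom.homM x = f x := rfl

/-- `isoOfEquivariant'` on Galois groups is `β⁻¹`. [cite: MochizukiAbsTopIII2015, Definition 3.1 (ii) p.67] -/
@[simp] theorem isoOfEquivariant'_hom_homPi {P Q : TSObj} (hP : P.actionKer = ⊥) (hQ : Q.actionKer = ⊥)
    (hdP : DiscreteTopology P.pair.M) (hdQ : DiscreteTopology Q.pair.M) (β : Q.pair.Pi ≃ₜ* P.pair.Pi)
    (f : P.pair.M ≃ Q.pair.M) (hf : ∀ (q : Q.pair.Pi) (x : P.pair.M), f (β q • x) = q • f x) (g : P.pair.Pi) :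
    (isoOfEquivariant' hP hQ hdP hdQ β f hf).hom.homPi g = β.symm g := rfl

/-- The inverse of `isoOfEquivariant'` on arithmetic data is `f⁻¹`. [cite: MochizukiAbsTopIII2015, Definition 3.1 (ii) p.67] -/
@[simp] theorem isoOfEquivariant'_inv_homM {P Q : TSObj} (hP : P.actionKer = ⊥) (hQ : Q.actionKer = ⊥)
    (hdP : DiscreteTopology P.pair.M) (hdQ : DiscreteTopology Q.pair.M) (β : Q.pair.Pi ≃ₜ* P.pair.Pi)
    (f : P.pair.M ≃ Q.pair.M) (hf : ∀ (q : Q.pair.Pi) (x : P.pair.M), f (β q • x) = q • f x) (y : Q.pair.M) :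
    (isoOfEquivariant' hP hQ hdP hdQ β f hf).inv.homM y = f.symm y := rfl

/-- The mono-analyticized pair keeps the discrete topology of its arithmetic datum. [cite: MochizukiAbsTopIII2015, Remark 3.1.1 p.70] -/
theorem discreteTopology_monoAn (P : TSObj) (h : DiscreteTopology P.pair.M) : DiscreteTopology (monoAn.obj P).pair.M := h

end TSObj

/-! ## Part 3. Along a Galois-isomorphism of the holomorphic model, the LCFT transport IS `σ_f` -/

namespace TFModel

variable {p : ℕ} [Fact p.Prime] {A B : TFModel p}

/-- `σ_f` restricted to `k̄^× = ℚ̄_p^×` as a multiplicative isomorphism of non-zero-divisors.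
[cite: MochizukiAbsTopIII2015, Definition 3.1 (ii) p.67] -/
def Hom.galoisNonZero (f : Hom A B) : ↥(PadicAlgCl p)⁰ ≃* ↥(PadicAlgCl p)⁰ where
  toFun x := ⟨f.galois x.1, mem_nonZeroDivisors_of_ne_zero (f.galois_ne_zero (nonZeroDivisors.coe_ne_zero x))⟩
  invFun y := ⟨f.galois.symm y.1, mem_nonZeroDivisors_of_ne_zero
    ((map_ne_zero_iff f.galois.symm f.galois.symm.injective).2 (nonZeroDivisors.coe_ne_zero y))⟩
  left_inv x := Subtype.ext (f.galois.symm_apply_apply x.1)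
  right_inv y := Subtype.ext (f.galois.apply_symm_apply y.1)
  map_mul' x y := Subtype.ext (map_mul f.galois x.1 y.1)

/-- `galoisNonZero` on values is `σ_f`. [cite: MochizukiAbsTopIII2015, Definition 3.1 (ii) p.67] -/
@[simp] theorem Hom.coe_galoisNonZero (f : Hom A B) (x : ↥(PadicAlgCl p)⁰) :
    (f.galoisNonZero x).1 = f.galois x.1 :=
  rfl

/-- `𝒪_k̄ ⊆ ℚ̄_p` over the base `k` of a model object is the closed unit ball (base-independence of `𝒪_k̄`, tower form).
[cite: MochizukiAbsTopIII2015, Definition 3.1 (i) p.66] -/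
theorem mem_integersClosure_closure_iff (A : TFModel p) (x : PadicAlgCl p) :
    x ∈ integersClosure (closure A).k (closure A).K ↔ ‖x‖ ≤ 1 :=
  letI := PadicAlgCl.subfieldValuativeRel A.k
  mem_integersClosure_tower_iff p (k := A.k) (PadicAlgCl.mem_integer_subfield_iff A.k) x

/-- **`σ_f|_{k̄^×}` is a transport along `conj(σ_f) : G_{k₁} ⥲ G_{k₂}`** in the sense of abc-iut-w6-d036 (equivariant and
integer-preserving). [cite: MochizukiAbsTopIII2015, Prop 5.8 (ii) p. 139] -/
theorem Hom.isTransport_galoisNonZero (f : Hom A B) :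
    MLFClosure.IsTransport (C₁ := closure A) (C₂ := closure B) (MLFClosure.homIso ((toMonoBase p).map f)) f.galoisNonZero := by
  refine ⟨fun σ x => ?_, fun x hx => ?_⟩
  · -- equivariance: `σ_f (σ x) = (σ_f σ σ_f⁻¹) (σ_f x)`
    change f.galois ((σ : PadicAlgCl p ≃ₐ[A.k] PadicAlgCl p) x.1) =
      (MLFClosure.homIso ((toMonoBase p).map f) σ : PadicAlgCl p ≃ₐ[B.k] PadicAlgCl p) (f.galois x.1)
    rw [toMonoBase_map_iso_apply, AlgEquiv.symm_apply_apply]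
    exact rfl
  · -- integers: `‖σ_f x‖ = ‖x‖`
    refine ⟨(mem_integersClosure_closure_iff B _).mpr ?_, f.galois_ne_zero hx.2⟩
    change ‖f.galois x.1‖ ≤ 1
    rw [Hom.norm_galois]
    exact (mem_integersClosure_closure_iff A x.1).mp hx.1

/-- Hence **the canonical LCFT transport along `conj(σ_f)` IS `σ_f`** (uniqueness of transports, abc-iut-w6-d036's
`IsTransport.eq_transport`): the genuine functorial containers of Prop 5.8 (ii) act on the image of the holomorphic model
by the field isomorphisms themselves. [cite: MochizukiAbsTopIII2015, Prop 5.8 (ii) p. 139] -/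
theorem Hom.transport_toMonoBase_map (f : Hom A B) (x : ↥((closure A).K)⁰) :
    (MLFClosure.transport (C₁ := closure A) (C₂ := closure B) (MLFClosure.homIso ((toMonoBase p).map f)) x).1 =
      f.galois x.1 := by
  rw [← (Hom.isTransport_galoisNonZero f).eq_transport]
  rfl

end TFModel

/-! ## Part 4. The four components of `η⊢_{v,ν}` at an open-augmentation object -/

namespace TFModel

variable {p : ℕ} [Fact p.Prime] (A : TFModel p)

/-! ### `ν = 𝒪^×`: `(G_k ↷ 𝒪^×_k̄(G_k)) ≅ (Π_k/Ker ↷ 𝒪^×_k̄)` -/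

/-- The carrier identification at `𝒪^×`: the units over the base `k` ARE the units over `ℚ_p` (same subset of `ℚ̄_p`).
[cite: MochizukiAbsTopIII2015, Definition 5.4 (iii) p.126] -/
def unitsCarrierEquiv : ↥(unitSubmonoid (closure A).k (closure A).K) ≃ UnitsCarrier p where
  toFun x := UnitsCarrier.mk x.1 ((SetLike.ext_iff.mp (PadicAlgCl.unitSubmonoid_subfield_eq A.k) x.1).mp x.2)
  invFun u := ⟨u.val, (SetLike.ext_iff.mp (PadicAlgCl.unitSubmonoid_subfield_eq A.k) u.val).mpr u.val_mem⟩
  left_inv _ := rfl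
  right_inv _ := rfl

/-- **`η⊢` at the vertex `𝒪^×`**: the `𝒞_TS`-isomorphism `(G_k ↷ 𝒪^×_k̄(G_k)) ≅ (Π_k/Ker ε_k ↷ 𝒪^×_k̄)` (Galois leg
`(Π_k/Ker ≃ₜ* G_k)⁻¹`, data leg the identity of `𝒪^×_{ℚ̄_p}`). [cite: MochizukiAbsTopIII2015, Cor 5.10 (iv)(c) p. 148] -/
def etaUnitsIso (hA : IsOpenMap A.D.aug) : MLFClosure.unitsObj (closure A) ≅ TSObj.monoAn.obj A.lamUnitsObj :=
  haveI : @Subgroup.Normal A.pair.Pi _ A.lamUnitsObj.actionKer := TSObj.actionKer_normal A.lamUnitsObj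
  TSObj.isoOfEquivariant' (MLFClosure.unitsObj_actionKer (closure A)) (TSObj.actionKer_monoAn _)
    (MLFClosure.unitsObj_discreteTopology (closure A)) (TSObj.discreteTopology_monoAn _ (inferInstanceAs (DiscreteTopology (UnitsCarrier p))))
    (A.augQuotientIso A.lamUnitsObj.actionKer A.lamUnitsObj_actionKer hA) A.unitsCarrierEquiv fun q x => by
      induction q using QuotientGroup.induction_on with
      | H g => exact UnitsCarrier.ext rfl

/-- `η⊢` at `𝒪^×` on data: the identity of `𝒪^×_{ℚ̄_p}`. [cite: MochizukiAbsTopIII2015, Cor 5.10 (iv)(c) p. 148] -/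
@[simp] theorem etaUnitsIso_hom_homM_val (hA : IsOpenMap A.D.aug) (x : ↥(unitSubmonoid (closure A).k (closure A).K)) :
    (((A.etaUnitsIso hA).hom.homM (show (MLFClosure.unitsObj (closure A)).pair.M from x) : UnitsCarrier p)).val = x.1 := rfl

/-- `η⊢` at `𝒪^×` on Galois groups: `ε_k(g) ↦ [g]`. [cite: MochizukiAbsTopIII2015, Cor 5.10 (iv)(c) p. 148] -/
theorem etaUnitsIso_hom_homPi_aug (hA : IsOpenMap A.D.aug) (g : A.pair.Pi) :
    (A.etaUnitsIso hA).hom.homPi (show (MLFClosure.unitsObj (closure A)).pair.Pi from A.D.aug g) =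
      (show (TSObj.monoAn.obj A.lamUnitsObj).pair.Pi from QuotientGroup.mk g) := by
  haveI : @Subgroup.Normal A.pair.Pi _ A.lamUnitsObj.actionKer := TSObj.actionKer_normal A.lamUnitsObj
  exact A.augQuotientIso_symm_aug _ _ hA g

/-! ### `ν = k̄^×`: `(G_k ↷ k̄^×(G_k)) ≅ (Π_k/Ker ↷ k̄^×)` -/

/-- The carrier identification at `k̄^×`: non-zero-divisors versus units of `ℚ̄_p`. [cite: MochizukiAbsTopIII2015, Definition 3.1 (iv) p.69] -/
def timesCarrierEquiv : ↥((closure A).K)⁰ ≃ TimesCarrier p where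
  toFun x := TimesCarrier.ofUnits (MLFClosure.unitsOfNonZero (closure A) x)
  invFun u := (MLFClosure.unitsOfNonZero (closure A)).symm u.toUnits
  left_inv _ := rfl
  right_inv _ := TimesCarrier.ext rfl

/-- **`η⊢` at the vertex `k̄^×`**: `(G_k ↷ k̄^×(G_k)) ≅ (Π_k/Ker ε_k ↷ k̄^×)`. [cite: MochizukiAbsTopIII2015, Cor 5.10 (iv)(c) p. 148] -/
def etaTimesIso (hA : IsOpenMap A.D.aug) : MLFClosure.timesObj (closure A) ≅ TSObj.monoAn.obj A.lamTimesObj :=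
  haveI : @Subgroup.Normal A.pair.Pi _ A.lamTimesObj.actionKer := TSObj.actionKer_normal A.lamTimesObj
  TSObj.isoOfEquivariant' (MLFClosure.timesObj_actionKer (closure A)) (TSObj.actionKer_monoAn _)
    (MLFClosure.timesObj_discreteTopology (closure A)) (TSObj.discreteTopology_monoAn _ (inferInstanceAs (DiscreteTopology (TimesCarrier p))))
    (A.augQuotientIso A.lamTimesObj.actionKer A.lamTimesObj_actionKer hA) A.timesCarrierEquiv fun q x => by
      induction q using QuotientGroup.induction_on with
      | H g => exact TimesCarrier.ext rfl

/-- `η⊢` at `k̄^×` on data: `x ↦ x`. [cite: MochizukiAbsTopIII2015, Cor 5.10 (iv)(c) p. 148] -/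
@[simp] theorem etaTimesIso_hom_homM_coe (hA : IsOpenMap A.D.aug) (x : ↥((closure A).K)⁰) :
    (((A.etaTimesIso hA).hom.homM (show (MLFClosure.timesObj (closure A)).pair.M from x) : TimesCarrier p).toUnits :
      PadicAlgCl p) = x.1 := rfl

/-! ### `ν = k~ = (𝒪^×)^pf`: `(G_k ↷ 𝒪^×_k̄(G_k) ⧸ μ) ≅ (Π_k/Ker ↷ k̄)` by the genuine logarithm -/

/-- `log_k̄` over the base `k` of a model object: abc-iut-L6-d2's `GaloisPadicLog.ofPadicSubfield k` (`log = padicLogAlgCl`).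
[cite: MochizukiAbsTopIII2015, Definition 3.1 (i) p.66] -/
def closureLog : GaloisPadicLog (closure A).k (closure A).K := GaloisPadicLog.ofPadicSubfield A.k

/-- Its logarithm is the tree's `padicLogAlgCl`. [cite: MochizukiAbsTopIII2015, Definition 3.1 (i) p.66] -/
@[simp] theorem closureLog_log : (A.closureLog).log = padicLogAlgCl p := rfl

/-- The carrier identification at `k~`: **`log_k̄ : 𝒪^×_k̄ ⧸ μ ⥲ (k̄, +)`** (abc-iut-L6-d2's `logEquiv`), landing in
abc-iut-w4-d095's additive carrier `k~ = k̄` (log-coordinates). [cite: MochizukiAbsTopIII2015, Definition 3.1 (i) p.66] -/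
def shellCarrierEquiv : MLFClosure.UnitsPf (closure A) ≃ AddCarrier p where
  toFun x := AddCarrier.of (Multiplicative.toAdd (A.closureLog.logEquiv x))
  invFun y := A.closureLog.logEquiv.symm (Multiplicative.ofAdd y.val)
  left_inv x := by
    change A.closureLog.logEquiv.symm (Multiplicative.ofAdd (Multiplicative.toAdd (A.closureLog.logEquiv x))) = x
    rw [ofAdd_toAdd, MulEquiv.symm_apply_apply]
  right_inv y := by
    apply AddCarrier.ext
    change Multiplicative.toAdd (A.closureLog.logEquiv (A.closureLog.logEquiv.symm (Multiplicative.ofAdd y.val))) = y.val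
    rw [MulEquiv.apply_symm_apply, toAdd_ofAdd]

/-- `shellCarrierEquiv [u] = log_k̄ u`. [cite: MochizukiAbsTopIII2015, Definition 3.1 (i) p.66] -/
@[simp] theorem shellCarrierEquiv_mk (u : ↥(unitGroup (closure A).k (closure A).K)) :
    (A.shellCarrierEquiv (MLFClosure.toUnitsPf (closure A) u)).val = padicLogAlgCl p (u : ((closure A).K)ˣ).1 :=
  rfl

/-- **`η⊢` at the vertex `k~`**: the `𝒞_TS`-isomorphism `(G_k ↷ k~(G_k)) ≅ (Π_k/Ker ε_k ↷ k~)`, `k~(G_k) = 𝒪^×_k̄ ⧸ μ` on the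
mono-analytic side and `k~ = k̄` (log-coordinates) on the holomorphic side — the data leg is the GENUINE `p`-adic logarithm
`log_k̄ : (𝒪^×_k̄)^pf ⥲ k̄` (Def 3.1 (i)), `G_k`-equivariant by `logEquiv_map_galois`. [cite: MochizukiAbsTopIII2015, Cor 5.10 (iv)(c) p. 148] -/
def etaShellIso (hA : IsOpenMap A.D.aug) : MLFClosure.unitsPfObj (closure A) ≅ TSObj.monoAn.obj A.lamAddObj :=
  haveI : @Subgroup.Normal A.pair.Pi _ A.lamAddObj.actionKer := TSObj.actionKer_normal A.lamAddObj
  TSObj.isoOfEquivariant' (MLFClosure.unitsPfObj_actionKer (closure A)) (TSObj.actionKer_monoAn _)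
    (MLFClosure.unitsPfObj_discreteTopology (closure A)) (TSObj.discreteTopology_monoAn _ (inferInstanceAs (DiscreteTopology (AddCarrier p))))
    (A.augQuotientIso A.lamAddObj.actionKer A.lamAddObj_actionKer hA) A.shellCarrierEquiv fun q x => by
      induction q using QuotientGroup.induction_on with
      | H g =>
        induction x using QuotientGroup.induction_on with
        | H u =>
          apply AddCarrier.ext
          change Multiplicative.toAdd (A.closureLog.logEquiv
              (QuotientGroup.mk ((closure A).galUnitGroupHom (A.D.aug g) u))) =
            A.augQ g (Multiplicative.toAdd (A.closureLog.logEquiv (QuotientGroup.mk u)))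
          have h := congrArg Multiplicative.toAdd (A.closureLog.logEquiv_map_galois (A.D.aug g) u)
          rw [toAdd_ofAdd] at h
          rw [augQ_apply]
          exact h

/-- `η⊢` at `k~` on data: `[u] ↦ log_k̄ u`. [cite: MochizukiAbsTopIII2015, Cor 5.10 (iv)(c) p. 148] -/
@[simp] theorem etaShellIso_hom_homM_mk (hA : IsOpenMap A.D.aug) (u : ↥(unitGroup (closure A).k (closure A).K)) :
    ((A.etaShellIso hA).hom.homM (show (MLFClosure.unitsPfObj (closure A)).pair.M from MLFClosure.toUnitsPf (closure A) u) :
      AddCarrier p).val = padicLogAlgCl p (u : ((closure A).K)ˣ).1 := rfl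

/-! ### `ν = (k̄^×)^pf`: `(G_k ↷ k̄^×(G_k) ⧸ μ) ≅ (Π_k/Ker ↷ k̄^× ⧸ μ)` -/

/-- The carrier identification at `(k̄^×)^pf`: this seat's `TimesPf (closure A) = ℚ̄_pˣ ⧸ μ` versus abc-iut-L4-t9's
`TimesPfCarrier = ℚ̄_pˣ ⧸ μ` (identity on classes). [cite: MochizukiAbsTopIII2015, Definition 3.1 (iv) p.69] -/
def perfCarrierEquiv : MLFClosure.TimesPf (closure A) ≃ TimesPfCarrier p where
  toFun := QuotientGroup.map _ (rootsOfUnityTorsion p)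
    (⟨⟨TimesCarrier.ofUnits, rfl⟩, fun _ _ => rfl⟩ : ((closure A).K)ˣ →* TimesCarrier p)
    (MLFClosure.torsion_le_comap_of_monoidHom _)
  invFun := QuotientGroup.map (rootsOfUnityTorsion p) _
    (⟨⟨TimesCarrier.toUnits, rfl⟩, fun _ _ => rfl⟩ : TimesCarrier p →* ((closure A).K)ˣ)
    (MLFClosure.torsion_le_comap_of_monoidHom _)
  left_inv x := by
    induction x using QuotientGroup.induction_on with
    | H u => rfl
  right_inv x := by
    induction x using QuotientGroup.induction_on with
    | H u => rfl

/-- `perfCarrierEquiv [u] = [u]`. [cite: MochizukiAbsTopIII2015, Definition 3.1 (iv) p.69] -/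
@[simp] theorem perfCarrierEquiv_mk (u : ((closure A).K)ˣ) :
    A.perfCarrierEquiv (MLFClosure.toTimesPf (closure A) u) = timesToPf (TimesCarrier.ofUnits u) := rfl

/-- **`η⊢` at the vertex `(k̄^×)^pf`**: `(G_k ↷ (k̄^×(G_k))^pf) ≅ (Π_k/Ker ε_k ↷ (k̄^×)^pf)`. [cite: MochizukiAbsTopIII2015, Cor 5.10 (iv)(c) p. 148] -/
def etaPerfIso (hA : IsOpenMap A.D.aug) : MLFClosure.timesPfObj (closure A) ≅ TSObj.monoAn.obj A.lamTimesPfObj :=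
  haveI : @Subgroup.Normal A.pair.Pi _ A.lamTimesPfObj.actionKer := TSObj.actionKer_normal A.lamTimesPfObj
  TSObj.isoOfEquivariant' (MLFClosure.timesPfObj_actionKer (closure A)) (TSObj.actionKer_monoAn _)
    (MLFClosure.timesPfObj_discreteTopology (closure A)) (TSObj.discreteTopology_monoAn _ (inferInstanceAs (DiscreteTopology (TimesPfCarrier p))))
    (A.augQuotientIso A.lamTimesPfObj.actionKer A.lamTimesPfObj_actionKer hA) A.perfCarrierEquiv fun q x => by
      induction q using QuotientGroup.induction_on with
      | H g =>
        induction x using QuotientGroup.induction_on with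
        | H u =>
          change A.perfCarrierEquiv (MLFClosure.toTimesPf (closure A) ((closure A).galUnitsHom (A.D.aug g) u)) =
            unitsPfGal (A.augQ g) (A.perfCarrierEquiv (MLFClosure.toTimesPf (closure A) u))
          rw [perfCarrierEquiv_mk, perfCarrierEquiv_mk, unitsPfGal_mk]
          exact congrArg timesToPf (TimesCarrier.ext rfl)

/-- `η⊢` at `(k̄^×)^pf` on data: `[u] ↦ [u]`. [cite: MochizukiAbsTopIII2015, Cor 5.10 (iv)(c) p. 148] -/
@[simp] theorem etaPerfIso_hom_homM_mk (hA : IsOpenMap A.D.aug) (u : ((closure A).K)ˣ) :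
    (A.etaPerfIso hA).hom.homM (show (MLFClosure.timesPfObj (closure A)).pair.M from MLFClosure.toTimesPf (closure A) u) =
      (show (TSObj.monoAn.obj A.lamTimesPfObj).pair.M from timesToPf (TimesCarrier.ofUnits u)) := rfl

end TFModel

end AbsTopIII

end Literature.AnabelianGeometry.AbsoluteAnabelian

end
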